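import Mathlib
import Summits.ResolutionOfSingularities.ResolutionOfSingularities.Theorems.WildQuotientsWildQuotientResolutionS1PlanarFieldDefs
import Summits.ResolutionOfSingularities.ResolutionOfSingularities.Theorems.WildConesClassicalRegimesStubMuDropCharTwoOrdPLeaves
import Literature.RingTheory.MvPowerSeries.FiniteColength
import Literature.AlgebraicGeometry.Resolution.CobordantArcLemma
import Summits.ResolutionOfSingularities.ResolutionOfSingularities.Theorems.WildQuotientsWildQuotientResolutionS1PlanarFieldIsolatedSucc

/-!
(FILE 2/3: Part II-a — 2×2 nilpotency, substitutions, the SHEAR; decls VERBATIM from res-L1-w45c-idea-1 `w1n/S1W1NTransport.lean` 5281fd5e869a68b1)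

# S1 / W1N cascade — planar-field TRANSPORT TOOLKIT: `IsolatedSucc` (Part I) + brick B3 (Part II)

FILING NOTE.  This file SUPERSEDES `S1W1NIsolatedSucc.lean` (a15dcc7e369fc152) for landing purposes:
Part I below is that file's declarations verbatim; Part II adds brick B3 of the line card
`W1N-LINE.md` (affine transport of `IsSucc`: `shear`, `swapField`, invariance of `milnor` /
`IsIsolated` / `IsSingular` / `IsBadNode` / `linearPart = 0`, and the reduction principle
`forall_isSucc_of_chart1_zero`).  Land ONE of the two, not both (same namespace, same names).

## Part I — support `IsolatedSucc`: successors of an isolated node are isolated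

Crux stmt-ResolutionOfSingularities-17941 (`WildQuotients.CyclicQuotientFourfolds`), S1a line `s1a-logminvertex`,
stub `stub_W1N_print`, sub-line `w1n-cascade` (idea-1 `W1N-LINE.md`): the second of the five supports of
`S1.W1NCascade.W1NPrint_of_cascade`.  [OURS · L1 W4.5c] — NOT a statement of the manuscript; counted 0 post-V5.

THEOREM `PlanarField.isIsolated_of_isSucc`: if `θ = (a, b)` is isolated (`κ⟦x,y⟧/(a,b)` finite over `κ`) and
`θ.IsSucc θ'` (D1: `θ'` is the SATURATED transform of `θ` in chart 1 at some `c`, or in chart 2) then `θ'` is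
isolated.

PROOF (characteristic-free, no Noether).  Chart 1 (`π : x ↦ x, y ↦ x(y + c)`): `𝔪^k ≤ (a, b)` for some `k`
(finite colength), so `x^k = u a + v b`; substituting, `x^k = (u∘π)(a∘π) + (v∘π)(b∘π)` with
`a∘π = x^s a'`, `b∘π = x^{s+1} b' + (y + c) x^s a'` — hence `x^k ∈ (a', b')`.  Saturation says `x ∤ a'` or
`x ∤ b'`; if `x ∤ g` with `g ∈ {a', b'}` then `κ⟦x,y⟧/(x, g)` is finite (its dimension is the `y`-order of
`g(0, y)`: tree `MuDropCharTwoOrdP.colength_X_eq_order`), so `𝔪^M ≤ (x, g)` and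
`𝔪^{M(k+1)} ≤ (x, g)^{k+1} ≤ (x^k) + (g) ≤ (a', b')`: finite colength.  Chart 2 is the same with `x ↔ y`
(transported through the swap automorphism of `κ⟦x,y⟧`).

With the cascade file (`S1.W1NCascade`) in scope,
`theorem isolatedSucc : S1.W1NCascade.IsolatedSucc := fun κ _ θ θ' h₁ h₂ => PlanarField.isIsolated_of_isSucc θ θ' h₁ h₂`.
-/

-- single-problem summit: the doubled namespace component `ResolutionOfSingularities` is forced
set_option linter.dupNamespace false

noncomputable section

open MvPowerSeries IsLocalRing
open Literature.AlgebraicGeometry.Resolution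
open Summit.ResolutionOfSingularities.ResolutionOfSingularities.Theorems.WildCones.MuDropCharTwoOrdP

namespace Summit.ResolutionOfSingularities.ResolutionOfSingularities.Theorems.WildQuotientResolution.S1.PlanarField

variable {κ : Type} [Field κ]
/-! # Part II — brick B3: AFFINE TRANSPORT of `IsSucc` (shear and swap) and its invariants

Every successor step is, after an affine-linear automorphism of `κ⟦x,y⟧` (paired with the matching
elementary operation on the ordered pair `(a, b)`), a CHART-1 STEP AT `c = 0`:
`IsSuccChart1 c θ θ' ↔ IsSuccChart1 0 (shear c θ) θ'` and
`IsSuccChart2 θ θ' ↔ IsSuccChart1 0 (swapField θ) (swapField θ')`; and `shear c`, `swapField`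
preserve `milnor`, `IsIsolated`, `IsSingular`, the trace and determinant of `linearPart` (it is
CONJUGATED), hence `IsBadNode` and `linearPart = 0`.  So each of `OStep` / `NStep` / `NTwoExit`
reduces to its chart-1-at-0 form (`forall_isSucc_of_chart1_zero`). [OURS · L1 W4.5c] -/

/-! ### 2 × 2 nilpotency over a field -/

/-- Over a field, a `2 × 2` matrix is nilpotent iff its trace and determinant vanish. [folklore] -/
theorem isNilpotent_iff_trace_det (L : Matrix (Fin 2) (Fin 2) κ) :
    IsNilpotent L ↔ L.trace = 0 ∧ L.det = 0 := by
  constructor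
  · intro h
    refine ⟨(Matrix.isNilpotent_trace_of_isNilpotent h).eq_zero, ?_⟩
    obtain ⟨m, hm⟩ := h
    have : IsNilpotent L.det := ⟨m, by rw [← Matrix.det_pow, hm, Matrix.det_zero]⟩
    exact this.eq_zero
  · rintro ⟨htr, hdet⟩
    rw [Matrix.trace_fin_two] at htr
    rw [Matrix.det_fin_two] at hdet
    refine ⟨2, ?_⟩
    rw [pow_two]
    ext i j
    fin_cases i <;> fin_cases j <;> simp [Matrix.mul_apply, Fin.sum_univ_two]
    · linear_combination L 0 0 * htr - hdet
    · linear_combination L 0 1 * htr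
    · linear_combination L 1 0 * htr
    · linear_combination L 1 1 * htr - hdet

/-! ### Linear algebra of substitutions with zero constant terms -/

/-- A substitution with zero constant terms preserves the constant coefficient. [folklore] -/
theorem constantCoeff_subst_of_constantCoeff_zero {φ : Fin 2 → MvPowerSeries (Fin 2) κ}
    (hφ : ∀ i, constantCoeff (φ i) = 0) (f : MvPowerSeries (Fin 2) κ) :
    constantCoeff (subst φ f) = constantCoeff f := by
  have hs := hasSubst_of_constantCoeff_zero hφ
  have hf : f = C (constantCoeff f) + (f - C (constantCoeff f)) := by ring
  conv_lhs => rw [hf]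
  rw [subst_add hs, subst_C, map_add, constantCoeff_C,
    constantCoeff_subst_eq_zero hs hφ (by simp), add_zero]

/-- First-order chain rule in two variables. [folklore] -/
theorem coeff_one_subst {φ : Fin 2 → MvPowerSeries (Fin 2) κ} (hφ : ∀ i, constantCoeff (φ i) = 0)
    (f : MvPowerSeries (Fin 2) κ) (j : Fin 2) :
    coeff (Finsupp.single j 1) (subst φ f) =
      coeff (Finsupp.single 0 1) f * coeff (Finsupp.single j 1) (φ 0) +
        coeff (Finsupp.single 1 1) f * coeff (Finsupp.single j 1) (φ 1) := by
  rw [CobordantArc.coeff_degree_one_subst φ hφ f _ (Finsupp.degree_single _ _), Fin.sum_univ_two]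

/-- `linearPart_apply_zero` (planar-field transport toolkit; see the module docstring). [OURS · L1 W4.5c] -/
theorem linearPart_apply_zero (θ : PlanarField κ) (j : Fin 2) :
    θ.linearPart 0 j = coeff (Finsupp.single j 1) θ.a := rfl

/-- `linearPart_apply_one` (planar-field transport toolkit; see the module docstring). [OURS · L1 W4.5c] -/
theorem linearPart_apply_one (θ : PlanarField κ) (j : Fin 2) :
    θ.linearPart 1 j = coeff (Finsupp.single j 1) θ.b := rfl

/-- `coeff_one_X_zero` (planar-field transport toolkit; see the module docstring). [OURS · L1 W4.5c] -/
theorem coeff_one_X_zero (j : Fin 2) :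
    coeff (Finsupp.single j 1) (X 0 : MvPowerSeries (Fin 2) κ) = if j = 0 then 1 else 0 := by
  fin_cases j <;> simp [coeff_X, Finsupp.single_eq_single_iff]

/-- `coeff_one_X_one` (planar-field transport toolkit; see the module docstring). [OURS · L1 W4.5c] -/
theorem coeff_one_X_one (j : Fin 2) :
    coeff (Finsupp.single j 1) (X 1 : MvPowerSeries (Fin 2) κ) = if j = 1 then 1 else 0 := by
  fin_cases j <;> simp [coeff_X, Finsupp.single_eq_single_iff]

/-! ### The shear `x ↦ x, y ↦ y + c·x` (paired with `b ↦ b − c·a`) -/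

/-- The shear substitution `x ↦ x, y ↦ y + c x`. -/
def shearVars (κ : Type) [Field κ] (c : κ) : Fin 2 → MvPowerSeries (Fin 2) κ := ![X 0, X 1 + C c * X 0]

/-- `shearVars_zero` (planar-field transport toolkit; see the module docstring). [OURS · L1 W4.5c] -/
theorem shearVars_zero (c : κ) : shearVars κ c 0 = X 0 := rfl

/-- `shearVars_one` (planar-field transport toolkit; see the module docstring). [OURS · L1 W4.5c] -/
theorem shearVars_one (c : κ) : shearVars κ c 1 = X 1 + C c * X 0 := rfl

/-- `constantCoeff_shearVars` (planar-field transport toolkit; see the module docstring). [OURS · L1 W4.5c] -/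
theorem constantCoeff_shearVars (c : κ) : ∀ i, constantCoeff (shearVars κ c i) = 0 := by
  intro i; fin_cases i <;> simp [shearVars, constantCoeff_X]

/-- `hasSubst_shearVars` (planar-field transport toolkit; see the module docstring). [OURS · L1 W4.5c] -/
theorem hasSubst_shearVars (c : κ) : HasSubst (shearVars κ c) :=
  hasSubst_of_constantCoeff_zero (constantCoeff_shearVars c)

/-- `subst_shearVars_X_zero` (planar-field transport toolkit; see the module docstring). [OURS · L1 W4.5c] -/
theorem subst_shearVars_X_zero (c : κ) : subst (shearVars κ c) (X 0 : MvPowerSeries (Fin 2) κ) = X 0 := by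
  rw [subst_X (R := κ) (hasSubst_shearVars (κ := κ) c)]; rfl

/-- `subst_shearVars_X_one` (planar-field transport toolkit; see the module docstring). [OURS · L1 W4.5c] -/
theorem subst_shearVars_X_one (c : κ) :
    subst (shearVars κ c) (X 1 : MvPowerSeries (Fin 2) κ) = X 1 + C c * X 0 := by
  rw [subst_X (R := κ) (hasSubst_shearVars (κ := κ) c)]; rfl

/-- `shear (-c)` undoes `shear c` on series. -/
theorem subst_shearVars_subst_shearVars_neg (c : κ) (f : MvPowerSeries (Fin 2) κ) :
    subst (shearVars κ c) (subst (shearVars κ (-c)) f) = f := by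
  rw [subst_comp_subst_apply (hasSubst_shearVars (κ := κ) (-c)) (hasSubst_shearVars (κ := κ) c)]
  have h : (fun s : Fin 2 => subst (shearVars κ c) (shearVars κ (-c) s)) = X := by
    funext s
    fin_cases s
    · exact subst_shearVars_X_zero c
    · show subst (shearVars κ c) (X 1 + C (-c) * X 0) = X 1
      rw [subst_add (hasSubst_shearVars (κ := κ) c), subst_mul (hasSubst_shearVars (κ := κ) c), subst_C,
        subst_shearVars_X_zero, subst_shearVars_X_one, map_neg]
      ring
  rw [h, subst_self]
  rfl

/-- The shear as a `κ`-algebra automorphism of `κ⟦x,y⟧`. -/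
def shearEquiv (c : κ) : MvPowerSeries (Fin 2) κ ≃ₐ[κ] MvPowerSeries (Fin 2) κ :=
  AlgEquiv.ofAlgHom (substAlgHom (hasSubst_shearVars c)) (substAlgHom (hasSubst_shearVars (-c)))
    (by ext1 f; simp [subst_shearVars_subst_shearVars_neg])
    (by ext1 f; simpa using subst_shearVars_subst_shearVars_neg (-c) f)

/-- `shearEquiv_apply` (planar-field transport toolkit; see the module docstring). [OURS · L1 W4.5c] -/
theorem shearEquiv_apply (c : κ) (f : MvPowerSeries (Fin 2) κ) : shearEquiv c f = subst (shearVars κ c) f := by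
  simp [shearEquiv]

/-- The sheared node: substitute `y ↦ y + c x` and replace `b` by `b − c·a` (so that the linear part is
CONJUGATED, not merely multiplied). [OURS · L1 W4.5c] -/
def shear (c : κ) (θ : PlanarField κ) : PlanarField κ :=
  ⟨subst (shearVars κ c) θ.a, subst (shearVars κ c) (θ.b - C c * θ.a)⟩

/-- `shear_a` (planar-field transport toolkit; see the module docstring). [OURS · L1 W4.5c] -/
theorem shear_a (c : κ) (θ : PlanarField κ) : (shear c θ).a = subst (shearVars κ c) θ.a := rfl

/-- `shear_b` (planar-field transport toolkit; see the module docstring). [OURS · L1 W4.5c] -/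
theorem shear_b (c : κ) (θ : PlanarField κ) :
    (shear c θ).b = subst (shearVars κ c) θ.b - C c * subst (shearVars κ c) θ.a := by
  show subst (shearVars κ c) (θ.b - C c * θ.a) = _
  rw [subst_sub (hasSubst_shearVars (κ := κ) c), subst_mul (hasSubst_shearVars (κ := κ) c), subst_C]

/-- `chart1 c = chart1 0 ∘ shear c` on series. -/
theorem subst_chart1_zero_subst_shearVars (c : κ) (f : MvPowerSeries (Fin 2) κ) :
    subst (chart1 (0 : κ)) (subst (shearVars κ c) f) = subst (chart1 c) f := by
  rw [subst_comp_subst_apply (hasSubst_shearVars (κ := κ) c) (hasSubst_chart1 (κ := κ) 0)]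
  congr 1
  funext s
  fin_cases s
  · show subst (chart1 (0 : κ)) (X 0 : MvPowerSeries (Fin 2) κ) = chart1 c 0
    rw [subst_X (R := κ) (hasSubst_chart1 (κ := κ) 0)]
    simp [chart1]
  · show subst (chart1 (0 : κ)) (X 1 + C c * X 0 : MvPowerSeries (Fin 2) κ) = chart1 c 1
    rw [subst_add (hasSubst_chart1 (κ := κ) 0), subst_mul (hasSubst_chart1 (κ := κ) 0), subst_C,
      subst_X (R := κ) (hasSubst_chart1 (κ := κ) 0), subst_X (R := κ) (hasSubst_chart1 (κ := κ) 0)]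
    simp [chart1]
    ring

/-- **B3 (shear).** A chart-1 step at `c` from `θ` is a chart-1 step at `0` from `shear c θ`, with the
SAME successor. [OURS · L1 W4.5c] -/
theorem isSuccChart1_iff_shear (c : κ) (θ θ' : PlanarField κ) :
    IsSuccChart1 c θ θ' ↔ IsSuccChart1 0 (shear c θ) θ' := by
  have hA : subst (chart1 (0 : κ)) (shear c θ).a = subst (chart1 c) θ.a := by
    rw [shear_a, subst_chart1_zero_subst_shearVars]
  have hB : subst (chart1 (0 : κ)) (shear c θ).b = subst (chart1 c) θ.b - C c * subst (chart1 c) θ.a := by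
    show subst (chart1 (0 : κ)) (subst (shearVars κ c) (θ.b - C c * θ.a)) = _
    rw [subst_chart1_zero_subst_shearVars, subst_sub (hasSubst_chart1 (κ := κ) c),
      subst_mul (hasSubst_chart1 (κ := κ) c), subst_C]
  unfold IsSuccChart1
  rw [hA, hB, map_zero, add_zero]
  constructor
  · rintro ⟨s, h1, h2, h3⟩
    exact ⟨s, h1, by rw [h2]; ring, h3⟩
  · rintro ⟨s, h1, h2, h3⟩
    exact ⟨s, h1, by rw [h2]; ring, h3⟩

/-- The ideal of the sheared node is the image of the ideal. -/
theorem span_shear (c : κ) (θ : PlanarField κ) :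
    Ideal.span ({(shear c θ).a, (shear c θ).b} : Set (MvPowerSeries (Fin 2) κ)) =
      (Ideal.span ({θ.a, θ.b} : Set (MvPowerSeries (Fin 2) κ))).map
        (shearEquiv (κ := κ) c : MvPowerSeries (Fin 2) κ →+* MvPowerSeries (Fin 2) κ) := by
  rw [Ideal.map_span, Set.image_pair, RingHom.coe_coe, shearEquiv_apply, shearEquiv_apply, shear_a, shear_b,
    Ideal.span_pair_sub_mul_left]

/-- `κ⟦x,y⟧/(a,b) ≃ₐ κ⟦x,y⟧/(shear)`. -/
def quotEquivShear (c : κ) (θ : PlanarField κ) :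
    (MvPowerSeries (Fin 2) κ ⧸ Ideal.span ({θ.a, θ.b} : Set (MvPowerSeries (Fin 2) κ))) ≃ₐ[κ]
      MvPowerSeries (Fin 2) κ ⧸ Ideal.span ({(shear c θ).a, (shear c θ).b} : Set (MvPowerSeries (Fin 2) κ)) :=
  Ideal.quotientEquivAlg _ _ (shearEquiv (κ := κ) c) (span_shear c θ)

/-- `milnor_shear` (planar-field transport toolkit; see the module docstring). [OURS · L1 W4.5c] -/
theorem milnor_shear (c : κ) (θ : PlanarField κ) : (shear c θ).milnor = θ.milnor :=
  ((quotEquivShear c θ).toLinearEquiv.finrank_eq).symm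

/-- `isIsolated_shear_iff` (planar-field transport toolkit; see the module docstring). [OURS · L1 W4.5c] -/
theorem isIsolated_shear_iff (c : κ) (θ : PlanarField κ) : (shear c θ).IsIsolated ↔ θ.IsIsolated := by
  unfold IsIsolated
  exact ⟨fun h => Module.Finite.equiv (quotEquivShear c θ).symm.toLinearEquiv,
    fun h => Module.Finite.equiv (quotEquivShear c θ).toLinearEquiv⟩

/-- `isSingular_shear_iff` (planar-field transport toolkit; see the module docstring). [OURS · L1 W4.5c] -/
theorem isSingular_shear_iff (c : κ) (θ : PlanarField κ) : (shear c θ).IsSingular ↔ θ.IsSingular := by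
  unfold IsSingular
  rw [shear_a, shear_b, map_sub, map_mul, constantCoeff_C,
    constantCoeff_subst_of_constantCoeff_zero (constantCoeff_shearVars c),
    constantCoeff_subst_of_constantCoeff_zero (constantCoeff_shearVars c)]
  constructor
  · rintro ⟨ha, hb⟩
    exact ⟨ha, by rw [ha, mul_zero, sub_zero] at hb; exact hb⟩
  · rintro ⟨ha, hb⟩
    exact ⟨ha, by rw [ha, hb, mul_zero, sub_zero]⟩

/-- The linear part of the sheared node is the CONJUGATE `P · L · P⁻¹`, `P = [[1,0],[-c,1]]`. -/
theorem linearPart_shear (c : κ) (θ : PlanarField κ) :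
    (shear c θ).linearPart = !![1, 0; -c, 1] * θ.linearPart * !![1, 0; c, 1] := by
  have hφ := constantCoeff_shearVars (κ := κ) c
  have h0 : ∀ j : Fin 2, (shear c θ).linearPart 0 j =
      θ.linearPart 0 0 * (if j = 0 then 1 else 0) + θ.linearPart 0 1 * ((if j = 1 then 1 else 0) + c * (if j = 0 then 1 else 0)) := by
    intro j
    rw [linearPart_apply_zero, shear_a, coeff_one_subst hφ, shearVars_zero, shearVars_one, coeff_one_X_zero,
      map_add, coeff_C_mul, coeff_one_X_zero, coeff_one_X_one, linearPart_apply_zero, linearPart_apply_zero]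
  have h1 : ∀ j : Fin 2, (shear c θ).linearPart 1 j =
      (θ.linearPart 1 0 - c * θ.linearPart 0 0) * (if j = 0 then 1 else 0) +
        (θ.linearPart 1 1 - c * θ.linearPart 0 1) * ((if j = 1 then 1 else 0) + c * (if j = 0 then 1 else 0)) := by
    intro j
    rw [linearPart_apply_one]
    show coeff (Finsupp.single j 1) (subst (shearVars κ c) (θ.b - C c * θ.a)) = _
    rw [coeff_one_subst hφ, shearVars_zero, shearVars_one, coeff_one_X_zero, map_add, coeff_C_mul,
      coeff_one_X_zero, coeff_one_X_one, map_sub, map_sub, coeff_C_mul, coeff_C_mul,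
      linearPart_apply_zero, linearPart_apply_zero, linearPart_apply_one, linearPart_apply_one]
  ext i j
  simp only [Matrix.mul_apply, Fin.sum_univ_two]
  fin_cases i <;> fin_cases j <;> simp [h0, h1] <;> ring

/-- `trace_linearPart_shear` (planar-field transport toolkit; see the module docstring). [OURS · L1 W4.5c] -/
theorem trace_linearPart_shear (c : κ) (θ : PlanarField κ) :
    (shear c θ).linearPart.trace = θ.linearPart.trace := by
  have hQP : (!![1, 0; c, 1] : Matrix (Fin 2) (Fin 2) κ) * !![1, 0; -c, 1] = 1 := by
    ext i j; fin_cases i <;> fin_cases j <;> simp [Matrix.mul_apply, Fin.sum_univ_two]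
  rw [linearPart_shear, Matrix.trace_mul_cycle, hQP, Matrix.one_mul]

/-- `det_linearPart_shear` (planar-field transport toolkit; see the module docstring). [OURS · L1 W4.5c] -/
theorem det_linearPart_shear (c : κ) (θ : PlanarField κ) :
    (shear c θ).linearPart.det = θ.linearPart.det := by
  rw [linearPart_shear, Matrix.det_mul, Matrix.det_mul, Matrix.det_fin_two_of, Matrix.det_fin_two_of]
  ring

/-- `isNilpotent_linearPart_shear_iff` (planar-field transport toolkit; see the module docstring). [OURS · L1 W4.5c] -/
theorem isNilpotent_linearPart_shear_iff (c : κ) (θ : PlanarField κ) :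
    IsNilpotent (shear c θ).linearPart ↔ IsNilpotent θ.linearPart := by
  rw [isNilpotent_iff_trace_det, isNilpotent_iff_trace_det, trace_linearPart_shear, det_linearPart_shear]

/-- `isBadNode_shear_iff` (planar-field transport toolkit; see the module docstring). [OURS · L1 W4.5c] -/
theorem isBadNode_shear_iff (c : κ) (θ : PlanarField κ) : (shear c θ).IsBadNode ↔ θ.IsBadNode := by
  unfold IsBadNode
  rw [isSingular_shear_iff, isNilpotent_linearPart_shear_iff]

/-- `linearPart_shear_eq_zero_iff` (planar-field transport toolkit; see the module docstring). [OURS · L1 W4.5c] -/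
theorem linearPart_shear_eq_zero_iff (c : κ) (θ : PlanarField κ) :
    (shear c θ).linearPart = 0 ↔ θ.linearPart = 0 := by
  have hPQ : (!![1, 0; c, 1] : Matrix (Fin 2) (Fin 2) κ) * !![1, 0; -c, 1] = 1 := by
    ext i j; fin_cases i <;> fin_cases j <;> simp [Matrix.mul_apply, Fin.sum_univ_two]
  rw [linearPart_shear]
  constructor
  · intro h
    have h' := congrArg (fun M => (!![1, 0; c, 1] : Matrix (Fin 2) (Fin 2) κ) * M * !![1, 0; -c, 1]) h
    simp only [Matrix.mul_zero, Matrix.zero_mul] at h'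
    rw [← h']
    rw [← Matrix.mul_assoc, ← Matrix.mul_assoc, hPQ, Matrix.one_mul, Matrix.mul_assoc, hPQ, Matrix.mul_one]
  · intro h
    rw [h, Matrix.mul_zero, Matrix.zero_mul]

end Summit.ResolutionOfSingularities.ResolutionOfSingularities.Theorems.WildQuotientResolution.S1.PlanarField

end
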